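import Literature.Computability.MetaComplexity.SmolenskyCorrelationRestrict
import Summits.QuantumAdvantage.AdviceFreeQNC0.CrossTeamEmbedding
import HarnessLib

/-!
# Cell qa-qnc0 (rung F-Q1, route RingFrame, crux α): degree bookkeeping for window functions

Small lemmas over the walk-game vocabulary (`HasDeg`, `wt`, `wtPrefix` of the cell topic) used by
`EndSupportedStrategies.lean`:

* `hasDeg_self`, `hasDeg_comp_window`: every Boolean function on `{0,1}^m` has degree `≤ m`
  (the monomials span, tree `Smolensky.span_range_mono_eq_top`), hence a function of a window of
  `m` coordinates has degree `≤ m` (`Smolensky.comp_subst_mem_lowDeg`);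
* `hasDeg_and`, `hasDeg_and_not`: conjunctions multiply indicators, degrees add;
* `wtPrefix_eq_card_window`, `wtSuffix_eq_card_window`, `wtPrefix_add_wtSuffix`: the prefix weight
  `W_g(u)` and the suffix weight `|u_{≥g}|` are weights of windows and sum to `|u|`.

Folklore bookkeeping; no cell statement is decided here.  WHAT THIS IS NOT: anything about α.
-/

noncomputable section

namespace Summit.QuantumAdvantage.AdviceFreeQNC0

open Finset
open Literature.Computability.MetaComplexity Literature.Computability.MetaComplexity.Smolensky

variable {n : ℕ}

/-! ### Degree bookkeeping: functions of few coordinates, conjunctions -/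

/-- Every Boolean function on `{0,1}^m` has degree `≤ m`. [folklore] -/
theorem hasDeg_self {m : ℕ} (φ : (Fin m → Bool) → Bool) : HasDeg φ m := by
  unfold HasDeg
  have hmem : (fun x => if φ x then (1 : ZMod 2) else 0) ∈
      Submodule.span (ZMod 2) (Set.range (mono (ZMod 2) (n := m))) := by
    rw [span_range_mono_eq_top]; exact Submodule.mem_top
  refine (Submodule.span_le.2 ?_) hmem
  rintro _ ⟨S, rfl⟩
  exact mono_mem_lowDeg ((Finset.card_le_univ S).trans (by rw [Fintype.card_fin]))

/-- A Boolean function of a window of `m` coordinates has degree `≤ m`.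
[cite: JuknaBFC2012, §2.1] -/
theorem hasDeg_comp_window {m : ℕ} (ι : Fin m → Fin n) (φ : (Fin m → Bool) → Bool) :
    HasDeg (fun u : Fin n → Bool => φ (fun j => u (ι j))) m := by
  have h := comp_subst_mem_lowDeg (F := ZMod 2)
    (fun (u : Fin n → Bool) (j : Fin m) => u (ι j)) (fun j => Or.inr ⟨ι j, fun u => rfl⟩)
    (hasDeg_self φ)
  exact h

/-- `HasDeg` is closed under conjunction, degrees adding (product of indicators). [folklore] -/
theorem hasDeg_and {k D D' : ℕ} {f g : (Fin k → Bool) → Bool} (hf : HasDeg f D) (hg : HasDeg g D') :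
    HasDeg (fun u => f u && g u) (D + D') := by
  unfold HasDeg at *
  have h : (fun x => if (f x && g x) = true then (1 : ZMod 2) else 0) =
      (fun x => if f x = true then (1 : ZMod 2) else 0) * (fun x => if g x = true then (1 : ZMod 2) else 0) := by
    funext x
    simp only [Pi.mul_apply]
    cases f x <;> cases g x <;> simp
  rw [h]
  exact mul_mem_lowDeg_add hf hg

/-- `HasDeg` is closed under `f ∧ ¬g`, degrees adding (`[f]·(1 + [g])`). [folklore] -/
theorem hasDeg_and_not {k D D' : ℕ} {f g : (Fin k → Bool) → Bool} (hf : HasDeg f D)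
    (hg : HasDeg g D') : HasDeg (fun u => f u && !g u) (D + D') := by
  unfold HasDeg at *
  have h1 : (1 : CubeFn (ZMod 2) k) ∈ lowDeg (ZMod 2) k D' := by
    rw [← mono_empty]; exact mono_mem_lowDeg (by simp)
  have h : (fun x => if (f x && !g x) = true then (1 : ZMod 2) else 0) =
      (fun x => if f x = true then (1 : ZMod 2) else 0) *
        ((1 : CubeFn (ZMod 2) k) + fun x => if g x = true then (1 : ZMod 2) else 0) := by
    funext x
    simp only [Pi.mul_apply, Pi.add_apply, Pi.one_apply]
    cases f x <;> cases g x <;> decide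
  rw [h]
  exact mul_mem_lowDeg_add hf (Submodule.add_mem _ h1 hg)

/-! ### Prefix and suffix weights as window functions -/

/-- The prefix weight `W_g(u)`, `g ≤ n`, is the weight of the window `u|_{[0,g)}`. [folklore] -/
theorem wtPrefix_eq_card_window (u : Fin n → Bool) {g : ℕ} (hg : g ≤ n) :
    wtPrefix u g = (univ.filter fun j : Fin g => u (Fin.castLE hg j) = true).card := by
  unfold wtPrefix
  rw [← Finset.card_map (Fin.castLEEmb hg)]
  congr 1
  ext i
  simp only [Finset.mem_filter, Finset.mem_univ, true_and, Finset.mem_map]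
  constructor
  · rintro ⟨hi, hui⟩
    exact ⟨⟨i.val, hi⟩, by simpa using hui, Fin.ext rfl⟩
  · rintro ⟨j, hj, rfl⟩
    exact ⟨j.isLt, hj⟩

/-- The suffix weight `|u_{≥ g}|`, `g ≤ n`, is the weight of the window `u|_{[g,n)}`. [folklore] -/
theorem wtSuffix_eq_card_window (u : Fin n → Bool) {g : ℕ} (hg : g ≤ n) :
    (univ.filter fun i : Fin n => g ≤ i.val ∧ u i = true).card =
      (univ.filter fun j : Fin (n - g) => u ⟨g + j.val, by omega⟩ = true).card := by
  rw [← Finset.card_image_of_injective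
    (univ.filter fun j : Fin (n - g) => u ⟨g + j.val, by omega⟩ = true)
    (f := fun j : Fin (n - g) => (⟨g + j.val, by omega⟩ : Fin n))
    (fun j j' h => by have := Fin.mk.inj_iff.1 h; exact Fin.ext (by omega))]
  congr 1
  ext i
  simp only [Finset.mem_filter, Finset.mem_univ, true_and, Finset.mem_image]
  constructor
  · rintro ⟨hi, hui⟩
    refine ⟨⟨i.val - g, by omega⟩, ?_, Fin.ext (by simp; omega)⟩
    have e : (⟨g + (i.val - g), by omega⟩ : Fin n) = i := Fin.ext (by simp; omega)
    rw [e]; exact hui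
  · rintro ⟨j, hj, rfl⟩
    exact ⟨by simp, hj⟩

/-- `W_g(u) + |u_{≥ g}| = |u|` for `g ≤ n`. [folklore] -/
theorem wtPrefix_add_wtSuffix (u : Fin n → Bool) (g : ℕ) :
    wtPrefix u g + (univ.filter fun i : Fin n => g ≤ i.val ∧ u i = true).card = wt u := by
  unfold wtPrefix wt
  rw [← Finset.card_union_of_disjoint]
  · congr 1
    ext i
    simp only [Finset.mem_union, Finset.mem_filter, Finset.mem_univ, true_and]
    constructor
    · rintro (⟨-, h⟩ | ⟨-, h⟩) <;> exact h
    · intro h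
      by_cases hi : i.val < g
      · exact Or.inl ⟨hi, h⟩
      · exact Or.inr ⟨by omega, h⟩
  · exact Finset.disjoint_filter.2 fun i _ h1 h2 => by omega

end Summit.QuantumAdvantage.AdviceFreeQNC0
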